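import Mathlib
import HarnessLib
import Summits.HubbardSuperconductivity.HubbardSuperconductivity.Theorems.KLProgrammeC4aPPKernelFamilyBelow
import Summits.HubbardSuperconductivity.HubbardSuperconductivity.Theorems.KLProgrammeC4aPPKernelOneSidedFlatness

/-!
# Route `KLProgramme` — crux C4a, S3 brick (B4) «(B4)-UMK1», «(M1)-FAMILY» part 4: the `[lo,hi]` rows of the family — `hK2d` (`C²`), `hK2` (`|Kr″| ≤ C₂ᶠ·max(e,|u|)⁻³`),
# `hsupp` in the two-sided form `|u| ≤ q_s·e ⇒ Kr′ = 0`, and the box flatness `hflat` — by TRANSFER from the one-sided kernel `K⁺` on `u > −e(1−t₁)/t₁` and from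
# the below branch `F = N·R₋` on `u < −e`

Cell `gate-hubbard-kl`, seat hubbard-kl-k3c3-p1 (g16; row «δμ-flow with klAngularMean constant piece»).  Located brick for the (C)-closer lane's `foldBox_law_rows`
(stmt-HubbardSuperconductivity-20437 (C)/(U1)) for the ONE family `Kr = ppFamilyKernel β Λ κ lo` (parts 1–3: `…Family`, `…FamilyNeg`, `…FamilyBelow`); memo
HOME/hubbard-kl-k3c3-p1/g16-M1-NEG-PRE-KERNEL.md §7.  Standing split hypotheses: `κ` with `HasDerivAt κ κ′`, `HasDerivAt κ′ κ″`, `κ″` continuous, `|κ|,|κ′|,|κ″| ≤ κ₀,κ₁,κ₂`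
on `[0,1]`, `κ = κ′ = κ″ = 0` on `[t₁,∞)`, and `0 < t₁ ≤ 2/5` (so that the zero zone `|u| ≤ e(1−t₁)/t₁ ⊇ [−3e/2, 3e/2]` separates the two live branches and contains the
anti-diagonal `u = −e`).
* §1 **`ppFamilyKernel_eq_oneSided`** (`lo ≤ e`, `−e(1−t₁)/t₁ < u ⟹ Kr(e,u) = K⁺(e,u)`) and its `𝓝`-version; the `𝓝`-version of part 3's `ppFamilyKernel_eq_below` on `u < −e`;
* §2 **`contDiff_two_ppFamilyKernel`** (`hK2d`); **`abs_iteratedDeriv_two_ppFamilyKernel_le`** (`hK2`: `≤ (C₂⁺ + C₂₋)·(max e |u|)⁻¹³`, `C₂⁺` of `…OneSidedRows`, `C₂₋` of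
  `…FamilyBelow`); **`deriv_ppFamilyKernel_eq_zero_of_abs_le`** (`hsupp`, `|u| ≤ ((1−t₁)/t₁)·e`); **`abs_intervalIntegral_box_flatness_family_le`** (`hflat` for
  `0 < D ≤ hi/t₁`, `= p687901` since `D − e > −e` lies in the `K⁺` zone).
Pure real analysis on Literature objects; nothing asserts (C), K3, the window or superconductivity.
References: BGM 2006 §2.4 (2.36) [cite: BenfattoGiulianiMastropietro2006]; FST II CPAM 51 (1998) §3 [cite: FeldmanSalmhoferTrubowitz1998]; Salmhofer 1999 §4.5.3
[cite: Salmhofer1999].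
-/

noncomputable section

namespace Summit.HubbardSuperconductivity.HubbardSuperconductivity.Theorems.C4a

set_option linter.dupNamespace false -- summit = problem name (single-conjunct summit), D-0017

open Real Filter Set MeasureTheory intervalIntegral
open scoped Topology Interval
open Literature.MathematicalPhysics.QuantumLattice Literature.Analysis.SpecialFunctions

section Rows

variable {β Λ : ℝ} (hβ : 0 < β) (hΛ : 0 < Λ) {B₁ B₂ : ℝ} (hB₁ : ∀ x, |deriv salmhoferCutoff x| ≤ B₁) (hB₂ : ∀ x, |deriv (deriv salmhoferCutoff) x| ≤ B₂)
  {κ κ' κ'' : ℝ → ℝ} (hκ : ∀ t, HasDerivAt κ (κ' t) t) (hκ' : ∀ t, HasDerivAt κ' (κ'' t) t) (hκ''c : Continuous κ'')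
  {κ₀ κ₁ κ₂ : ℝ} (hκb : ∀ t ∈ Icc 0 1, |κ t| ≤ κ₀) (hκ'b : ∀ t ∈ Icc 0 1, |κ' t| ≤ κ₁) (hκ''b : ∀ t ∈ Icc 0 1, |κ'' t| ≤ κ₂)
  {t₁ : ℝ} (ht₀ : 0 < t₁) (ht25 : t₁ ≤ 2 / 5) (hκs : ∀ t, t₁ ≤ t → κ t = 0) (hκ's : ∀ t, t₁ ≤ t → κ' t = 0) (hκ''s : ∀ t, t₁ ≤ t → κ'' t = 0)
  {lo : ℝ} (hlo : 0 < lo) {e : ℝ} (he : lo ≤ e)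

/-! ## §1 The two branches of the family at a level `e ≥ lo` -/

include ht₀ hκs hlo he in
/-- The floored split at a level `e ≥ lo` vanishes on the sharp zone `|u| ≤ e(1−t₁)/t₁`. [folklore] -/
theorem familySplit_eq_zero_sharp {u : ℝ} (hu : |u| ≤ e * (1 - t₁) / t₁) : κ (familyScale lo e / (familyScale lo e + |u|)) = 0 := by
  have he0 : 0 < e := hlo.trans_le he
  rw [familyScale_eq_abs (by rwa [abs_of_pos he0]), abs_of_pos he0]
  exact hκs _ (splitRatio_ge_of_le ht₀ (by linarith [abs_nonneg u]) hu)

include hβ ht₀ ht25 hκs hlo he in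
/-- **On `u > −e(1−t₁)/t₁` the family IS the one-sided kernel**: `Kr(e,u) = K⁺(e,u)` (both `P·κ(e/(e+u))` on `u > 0`, both `0` on the zone).
[cite: BenfattoGiulianiMastropietro2006, §2.4 (2.36)] -/
theorem ppFamilyKernel_eq_oneSided {u : ℝ} (hu : -(e * (1 - t₁) / t₁) < u) : ppFamilyKernel β Λ κ lo e u = ppOneSidedKernel β Λ κ e u := by
  have he0 : 0 < e := hlo.trans_le he
  rcases lt_or_ge 0 u with hpos | hnonpos
  · unfold ppFamilyKernel ppOneSidedKernel
    rw [if_pos hpos, familyScale_eq_abs (by rwa [abs_of_pos he0]), abs_of_pos he0, abs_of_pos hpos, ppTrueKernel_eq_div hβ Λ (by linarith : e + u ≠ 0)]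
    ring
  · have hzone : |u| ≤ e * (1 - t₁) / t₁ := by rw [abs_of_nonpos hnonpos]; linarith
    have h1t : 0 < 1 - t₁ := by linarith
    unfold ppFamilyKernel
    rw [familySplit_eq_zero_sharp ht₀ hκs hlo he hzone, mul_zero, ppOneSidedKernel_eq_zero_of_le ht₀ hκs he0 (hnonpos.trans (by positivity))]

include hβ ht₀ ht25 hκs hlo he in
/-- `𝓝`-version: near any `u₁ > −e(1−t₁)/t₁` the family and `K⁺(e,·)` agree. [folklore] -/
theorem ppFamilyKernel_eventuallyEq_oneSided {u₁ : ℝ} (hu₁ : -(e * (1 - t₁) / t₁) < u₁) :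
    (fun v : ℝ => ppFamilyKernel β Λ κ lo e v) =ᶠ[𝓝 u₁] fun v => ppOneSidedKernel β Λ κ e v := by
  filter_upwards [Ioi_mem_nhds hu₁] with v hv
  exact ppFamilyKernel_eq_oneSided hβ ht₀ ht25 hκs hlo he hv

include hβ hlo he in
/-- `𝓝`-version of part 3's `ppFamilyKernel_eq_below`: near any `u₁ < −e` the family is the below branch `N·R₋`. [folklore] -/
theorem ppFamilyKernel_eventuallyEq_below {u₁ : ℝ} (hu₁ : u₁ < -e) :
    (fun v : ℝ => ppFamilyKernel β Λ κ lo e v) =ᶠ[𝓝 u₁] fun v => ppTrueNumerator β Λ e v * (κ (e / (e - v)) / (e + v)) := by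
  have he0 : 0 < e := hlo.trans_le he
  filter_upwards [Iio_mem_nhds hu₁] with v hv
  have hv' : v < -e := hv
  exact ppFamilyKernel_eq_below hβ Λ κ hlo he (by linarith) (by linarith)

include ht₀ ht25 hlo he in
/-- Geometry of the zone at `t₁ ≤ 2/5`: `−e(1−t₁)/t₁ < −e` (the anti-diagonal point `u = −e` lies inside the zero zone) and `−e(1−t₁)/t₁ ≤ −3e/2`. [folklore] -/
theorem family_zone_geometry : -(e * (1 - t₁) / t₁) < -e ∧ -(e * (1 - t₁) / t₁) ≤ -(3 / 2 * e) := by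
  have he0 : 0 < e := hlo.trans_le he
  have h1 : 3 / 2 * e ≤ e * (1 - t₁) / t₁ := by rw [le_div_iff₀ ht₀]; nlinarith
  constructor <;> linarith

/-! ## §2 The `[lo,hi]` rows: `C²`, the second-derivative envelope, the two-sided support, the box flatness -/

include hβ hΛ hB₁ hB₂ hκ hκ' hκ''c ht₀ ht25 hκs hκ's hκ''s hlo he in
/-- **ROW `hK2d` FOR THE FAMILY**: at a level `e ≥ lo`, `u ↦ Kr(e,u)` is `C²` (the `K⁺` zone and the below branch are open and cover `ℝ`).
[cite: BenfattoGiulianiMastropietro2006, §2.4 (2.36)] -/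
theorem contDiff_two_ppFamilyKernel : ContDiff ℝ 2 (fun v : ℝ => ppFamilyKernel β Λ κ lo e v) := by
  have he0 : 0 < e := hlo.trans_le he
  have ht₁ : t₁ < 1 := by linarith
  obtain ⟨hzone, _⟩ := family_zone_geometry ht₀ ht25 hlo he
  have hκC : ContDiff ℝ 2 κ := contDiff_two_of_hasDerivAt₂ hκ hκ' hκ''c
  refine contDiff_iff_contDiffAt.2 fun u => ?_
  rcases lt_or_ge (-(e * (1 - t₁) / t₁)) u with hup | hdown
  · exact ((contDiff_two_ppOneSidedKernel hβ hΛ hB₁ hB₂ hκ hκ' hκ''c ht₀ ht₁ hκs hκ's hκ''s he0).contDiffAt).congr_of_eventuallyEq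
      (ppFamilyKernel_eventuallyEq_oneSided hβ ht₀ ht25 hκs hlo he hup)
  · have hu : u < -e := lt_of_le_of_lt hdown hzone
    have hm : e - u ≠ 0 := by linarith
    have hp : e + u ≠ 0 := by linarith
    have hN : ContDiffAt ℝ 2 (fun v : ℝ => ppTrueNumerator β Λ e v) u := (contDiff_two_ppTrueNumerator_u hβ hΛ hB₁ hB₂ e).contDiffAt
    have ha : ContDiffAt ℝ 2 (fun v : ℝ => e / (e - v)) u := contDiffAt_const.div (contDiffAt_const.sub contDiffAt_id) hm
    have hR : ContDiffAt ℝ 2 (fun v : ℝ => κ (e / (e - v)) / (e + v)) u :=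
      (hκC.contDiffAt.comp u ha).div (contDiffAt_const.add contDiffAt_id) hp
    exact (hN.mul hR).congr_of_eventuallyEq (ppFamilyKernel_eventuallyEq_below hβ hlo he hu)

include hβ hΛ hB₁ hB₂ hκ hκ' hκb hκ'b hκ''b ht₀ ht25 hκs hκ's hκ''s hlo he in
/-- **ROW `hK2` FOR THE FAMILY**: at a level `e ≥ lo`, for every `u`,
`|iteratedDeriv 2 Kr(e,·) u| ≤ (C₂⁺ + C₂₋)·(max e |u|)⁻¹³` with `C₂⁺ = κ₀(16B₂+24B₁+33)/(1−t₁)² + 2(κ₀+κ₁)(6B₁+5/2)/(1−t₁) + 2κ₀+4κ₁+κ₂` (the `K⁺` zone, p687519) and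
`C₂₋ = 3κ₀(16B₂+24B₁+33) + 2(6B₁+9/2)(3κ₁+9κ₀) + 3κ₂+24κ₁+54κ₀` (the below branch, part 3). [cite: BenfattoGiulianiMastropietro2006, §2.4 (2.36)] -/
theorem abs_iteratedDeriv_two_ppFamilyKernel_le (u : ℝ) :
    |iteratedDeriv 2 (fun v : ℝ => ppFamilyKernel β Λ κ lo e v) u| ≤
      ((κ₀ * ((16 * B₂ + 24 * B₁ + 33) / (1 - t₁) ^ 2) + 2 * (κ₀ + κ₁) * ((6 * B₁ + 5 / 2) / (1 - t₁)) + (2 * κ₀ + 4 * κ₁ + κ₂)) +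
        (3 * κ₀ * (16 * B₂ + 24 * B₁ + 33) + 2 * (6 * B₁ + 9 / 2) * (3 * κ₁ + 9 * κ₀) + (3 * κ₂ + 24 * κ₁ + 54 * κ₀))) * (max e |u|)⁻¹ ^ 3 := by
  have he0 : 0 < e := hlo.trans_le he
  have ht₁ : t₁ < 1 := by linarith
  have h1t : 0 < 1 - t₁ := by linarith
  have hB0 := salmhoferB₁_nonneg hB₁
  have hB20 : 0 ≤ B₂ := (abs_nonneg _).trans (hB₂ 0)
  have hκ₀ : 0 ≤ κ₀ := (abs_nonneg _).trans (hκb 0 (left_mem_Icc.2 zero_le_one))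
  have hκ₁ : 0 ≤ κ₁ := (abs_nonneg _).trans (hκ'b 0 (left_mem_Icc.2 zero_le_one))
  have hκ₂ : 0 ≤ κ₂ := (abs_nonneg _).trans (hκ''b 0 (left_mem_Icc.2 zero_le_one))
  have hM : 0 < max e |u| := he0.trans_le (le_max_left _ _)
  set Cp : ℝ := κ₀ * ((16 * B₂ + 24 * B₁ + 33) / (1 - t₁) ^ 2) + 2 * (κ₀ + κ₁) * ((6 * B₁ + 5 / 2) / (1 - t₁)) + (2 * κ₀ + 4 * κ₁ + κ₂) with hCp
  set Cm : ℝ := 3 * κ₀ * (16 * B₂ + 24 * B₁ + 33) + 2 * (6 * B₁ + 9 / 2) * (3 * κ₁ + 9 * κ₀) + (3 * κ₂ + 24 * κ₁ + 54 * κ₀) with hCm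
  have hCp0 : 0 ≤ Cp := by positivity
  have hCm0 : 0 ≤ Cm := by positivity
  obtain ⟨hzone, _⟩ := family_zone_geometry ht₀ ht25 hlo he
  rcases lt_or_ge (-(e * (1 - t₁) / t₁)) u with hup | hdown
  · -- the `K⁺` zone
    have heq : iteratedDeriv 2 (fun v : ℝ => ppFamilyKernel β Λ κ lo e v) u = iteratedDeriv 2 (fun v : ℝ => ppOneSidedKernel β Λ κ e v) u :=
      ((ppFamilyKernel_eventuallyEq_oneSided (Λ := Λ) hβ ht₀ ht25 hκs hlo he hup).iteratedDeriv 2).eq_of_nhds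
    rw [heq]
    refine (abs_iteratedDeriv_two_ppOneSidedKernel_le hβ hΛ hB₁ hB₂ hκ hκ' ht₀ ht₁ hκs hκ's hκ''s he0 hκb hκ'b hκ''b u).trans ?_
    exact mul_le_mul_of_nonneg_right (by linarith) (by positivity)
  · -- the below branch
    have hu : u < -e := lt_of_le_of_lt hdown hzone
    have hfar : e * (1 - t₁) / t₁ ≤ -u := by linarith
    have heq : iteratedDeriv 2 (fun v : ℝ => ppFamilyKernel β Λ κ lo e v) u =
        iteratedDeriv 2 (fun v : ℝ => ppTrueNumerator β Λ e v * (κ (e / (e - v)) / (e + v))) u :=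
      ((ppFamilyKernel_eventuallyEq_below (Λ := Λ) (κ := κ) hβ hlo he hu).iteratedDeriv 2).eq_of_nhds
    rw [heq, iteratedDeriv_succ, iteratedDeriv_one]
    -- `deriv F = F′` near `u`, then `deriv F′ u = F″ u`
    have hF' : deriv (fun v : ℝ => ppTrueNumerator β Λ e v * (κ (e / (e - v)) / (e + v))) =ᶠ[𝓝 u] fun v =>
        ppTrueNumeratorDu β Λ e v * (κ (e / (e - v)) / (e + v)) +
          ppTrueNumerator β Λ e v * (κ' (e / (e - v)) * (e / (e - v) ^ 2) / (e + v) - κ (e / (e - v)) / (e + v) ^ 2) := by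
      filter_upwards [Iio_mem_nhds hu] with v hv
      have hv' : v < -e := hv
      exact (hasDerivAt_below hβ hΛ hB₁ hκ (by linarith) (by linarith)).deriv
    rw [hF'.deriv_eq, (hasDerivAt_below1 hβ hΛ hB₁ hB₂ hκ hκ' (by linarith : e - u ≠ 0) (by linarith : e + u ≠ 0)).deriv]
    refine (abs_below2_le hβ hΛ hB₁ hB₂ hκb hκ'b hκ''b ht₀ ht25 he0 hfar).trans ?_
    exact mul_le_mul_of_nonneg_right (by linarith) (by positivity)

include hβ hΛ hB₁ hκ ht₀ ht25 hκs hκ's hlo he in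
/-- **ROW `hsupp` FOR THE FAMILY, two-sided form**: `|u| ≤ ((1−t₁)/t₁)·e ⟹ deriv Kr(e,·) u = 0` (on the zone `κ(a) = κ′(a) = 0`).
[cite: BenfattoGiulianiMastropietro2006, §2.4 (2.36)] -/
theorem deriv_ppFamilyKernel_eq_zero_of_abs_le {u : ℝ} (hu : |u| ≤ (1 - t₁) / t₁ * e) : deriv (fun v : ℝ => ppFamilyKernel β Λ κ lo e v) u = 0 := by
  have he0 : 0 < e := hlo.trans_le he
  have ht₁ : t₁ < 1 := by linarith
  have hm : familyScale lo e = e := by rw [familyScale_eq_abs (by rwa [abs_of_pos he0]), abs_of_pos he0]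
  have hzone : |u| ≤ e * (1 - t₁) / t₁ := by rw [div_mul_eq_mul_div, mul_comm] at hu; exact hu
  have ha : t₁ ≤ e / (e + |u|) := splitRatio_ge_of_le ht₀ (by linarith [abs_nonneg u]) hzone
  rw [deriv_ppFamilyKernel hβ hΛ hB₁ hκ ht₁ hκs hlo, hm, hκs _ ha, mul_zero, zero_add]
  rcases eq_or_ne u 0 with rfl | hne
  · rw [(hasDerivAt_splitWeight_zero he0 ht₁ hκs).deriv, mul_zero]
  · rw [(hasDerivAt_splitWeight hκ he0 hne).deriv, hκ's _ ha, zero_mul, mul_zero]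

include hβ ht₀ ht25 hκs hlo he in
/-- Along the anti-diagonal the family's derivative is `K⁺`'s: `0 < D ⟹ deriv Kr(e,·) (D−e) = deriv K⁺(e,·) (D−e)` (`D − e > −e` lies in the `K⁺` zone). [folklore] -/
theorem deriv_ppFamilyKernel_antidiag_eq {D : ℝ} (hD : 0 < D) :
    deriv (fun v : ℝ => ppFamilyKernel β Λ κ lo e v) (D - e) = deriv (fun v : ℝ => ppOneSidedKernel β Λ κ e v) (D - e) := by
  obtain ⟨hzone, _⟩ := family_zone_geometry ht₀ ht25 hlo he
  exact (ppFamilyKernel_eventuallyEq_oneSided (Λ := Λ) (κ := κ) hβ ht₀ ht25 hκs hlo he (by linarith)).deriv_eq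

end Rows

/-- **ROW `hflat` FOR THE FAMILY** (box form, `0 < D ≤ hi/t₁`, Lipschitz weight): the integrand coincides with `K⁺`'s along the anti-diagonal, so p687901's
`abs_intervalIntegral_box_flatness_le` applies verbatim. [cite: FeldmanSalmhoferTrubowitz1998, §3] -/
theorem abs_intervalIntegral_box_flatness_family_le {β Λ : ℝ} (hβ : 0 < β) (hΛ : 0 < Λ) {B₁ : ℝ} (hB₁ : ∀ x, |deriv salmhoferCutoff x| ≤ B₁)
    {κ κ' : ℝ → ℝ} (hκ : ∀ t, HasDerivAt κ (κ' t) t) (hκ'c : Continuous κ') {κ₀ κ₁ : ℝ} (hκb : ∀ t ∈ Icc 0 1, |κ t| ≤ κ₀) (hκ'b : ∀ t ∈ Icc 0 1, |κ' t| ≤ κ₁)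
    {t₁ : ℝ} (ht₀ : 0 < t₁) (ht25 : t₁ ≤ 2 / 5) (hκs : ∀ t, t₁ ≤ t → κ t = 0) (hκ's : ∀ t, t₁ ≤ t → κ' t = 0)
    {lo hi : ℝ} (hlo : 0 < lo) (hlohi : lo ≤ hi) {wt : ℝ → ℝ} {W W' : ℝ} (hwc : ContinuousOn wt (Icc lo hi))
    (hwW : ∀ e ∈ Icc lo hi, |wt e| ≤ W) (hW' : 0 ≤ W') (hwL : ∀ e ∈ Icc lo hi, |wt e - wt lo| ≤ W' * (e - lo)) {D : ℝ} (hD : 0 < D)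
    (hDhi : D ≤ hi / t₁) :
    |∫ e in lo..hi, wt e * deriv (fun v : ℝ => ppFamilyKernel β Λ κ lo e v) (D - e)| ≤
      W * (((6 * B₁ + 5 / 2) * (2 * κ₀ + κ₁) * (4 / (1 - t₁) ^ 2) + κ₀ * (10 * B₁ + 7 / 2 + 2 / (β * Λ) + 1 / (1 - t₁))) * (Λ / max D Λ ^ 2) +
          (κ₀ * ((6 * B₁ + 5 / 2) / (1 - t₁)) + κ₀ + κ₁) / (1 - t₁) ^ 2 * (lo / max D lo ^ 2)) +
        W' * (κ₀ * ((6 * B₁ + 5 / 2) / (1 - t₁)) + κ₀ + κ₁) * t₁ ^ 2 / (1 - t₁) ^ 2 := by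
  have ht₁ : t₁ < 1 := by linarith
  have hcongr : ∀ e ∈ uIcc lo hi, wt e * deriv (fun v : ℝ => ppFamilyKernel β Λ κ lo e v) (D - e) =
      wt e * deriv (fun v : ℝ => ppOneSidedKernel β Λ κ e v) (D - e) := fun e he => by
    rw [uIcc_of_le hlohi] at he
    rw [deriv_ppFamilyKernel_antidiag_eq hβ ht₀ ht25 hκs hlo he.1 hD]
  rw [intervalIntegral.integral_congr hcongr]
  exact abs_intervalIntegral_box_flatness_le hβ hΛ hB₁ hκ hκ'c hκb hκ'b ht₀ ht₁ hκs hκ's hlo hlohi hwc hwW hW' hwL hD hDhi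

end Summit.HubbardSuperconductivity.HubbardSuperconductivity.Theorems.C4a

end
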